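/-
Copyright (c) 2026 the pub-hodgecm-mathlib formalisation cell (harness21).  Prover seat hodgecm-mathlib-K2E3-p32 (g0), HCML Track B «K2-LIT» (close-out strike line L4
`stub_StCharTS`), h413 = `stmt-HodgeConjecture-24833`, line `K2_E3_EllipticInputs`, unit U4 «Keys», PART «U4Keys» socket :155 (U4f-χ₁-ram-one-d0B)
`sig_K2E3KeysThmTwoContractingRamifiedCharOneDepthZeroNormTrivial` (LINE-LEAD K2E3-plan (g5), deal D162 «d0B lead ∕ consumer», cell «U4-RAM»; Z3-c SHARED FRAME v1 (K2E3-p03 (g9));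
step (II)-c part 2 «THE CLOSED FORMS + THE HEADS `h11v`, `hwwv`», R0 head bytes of R90-C10-p01 (g2) 16:54:22Z, typed by the d0B lead after the cell's seats
closed (16:57Z) without filing it).  2026-09-04.
-/
import Summits.HodgeConjecture.HodgeConjecture.Theorems.K2E3BranchBCasselmanPairEntries          -- ★∕📤 (this seat) (II)-c part 1: the two big-cell entries as set integrals of `F₀` (`integral_toFun_weyl_mul_eq`, `integral_toFun_conj_weyl_eq`), `setOf_v_le_one_eq_setOf_mem`
import Summits.HodgeConjecture.HodgeConjecture.Theorems.K2E3KeysThmTwoDepthZeroBranchBFromDet     -- ★ (this seat) the d0B end assembly from `det M = 0` (for the head shapes `h11v`, `hwwv`); brings ★ Constants, the frame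
import Mathlib.MeasureTheory.Integral.Bochner.Basic
import HarnessLib

/-!
# K2 ∕ E3 «EllipticInputs», unit U4 «Keys» — (U4f-χ₁-ram-one-d0B) step (II)-c, part 2: THE CLOSED FORMS `c·Y∕(1+Y)`, `−c∕(1+Y)` OF THE TWO BIG-CELL ENTRIES FROM THE THREE SHELL
# IDENTITIES, AND THE HEADS `h11v`, `hwwv` OF THE END ASSEMBLY (part 1 = ★∕📤 `K2E3BranchBCasselmanPairEntries`: the entries as set integrals of `F₀`)
# [Casselman1980 §3; Casselman1995 §6.4; Keys1984 §7 Thm (2); Rogawski1990 §12.1–§12.2]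

Cell `pub/hodgecm-mathlib`, crux H413 = `stmt-HodgeConjecture-24833`, route of record `HCCMUnconditional`; chair K2-lead (g2), LINE-LEAD∕dealer K2E3-plan (g5), architect K2E3-p25
(g3); cell «U4-RAM» (Z3-c frame v1 `K2/K2E3-p03/g9/Z3c-frame.v1.txt`, K2E3-p03 (g9); (II)-c dealt to R90-C10-p01 (g2) 16:51:43Z, R0 16:54:22Z, seat closed before GREEN — typed here
on exactly those heads by the consumer).  THEOREMS ONLY (no `def`, no `instance`, no `notation`, no named-fact hypothesis, no `sorry`); lane `--supports stmt-HodgeConjecture-24833 --as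
helper`, count-neutral.  NOT THE PAYER: the three SHELL IDENTITIES (`hscal`, `h1` = (II)-a `K2E3BranchBShellScaling`; `h0` = (II)-b3 `K2E3BranchBShellZero`), `IntegrableOn F₀ S_ge` and the
Borel-ness of the regions stay hypotheses (frame-v1 heads, verbatim up to the carrier spelling `↥(cmBorelTriple L 3 v).N = ↥(unipotentU σ J)` (`rfl`)).

THE POINT.  ★ (I) `K2E3BranchBCasselmanPairIntegrands` computes, for an `(I, θ)`-eigen-section `f` of `i(χ₁, χ₂)` on `U(Φ₃)(L⁺_v)`, `f(w₀u)` and `f(w₀uw₀)` pointwise in terms of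
`z = u₀₂`: off the small regions they are `χ₁((σz)⁻¹)·χ₂(−1)·‖z‖⁻¹` times `f(1)` resp. `f(w₀)`, and `0` on them for the normalised vectors.  With `θ(b) = χ₁(b₀₀)` (depth zero; `hθ1`
discharged: `θ = 1` at `b₀₀ = 1`) and the frame-v1 integrand `F₀(n) = χ₁((σz)⁻¹)·‖z‖⁻¹` (the `dite` on `IsUnit z`, value `0` off the units), this file reads the two BIG-CELL entries as
SET INTEGRALS — `Λ_1 f₁ = χ₂(−1)·f₁(1)·∫_{S_gt} F₀`, `Λ_{w₀} f_w = χ₂(−1)·f_w(w₀)·∫_{S_ge} F₀` (`S_gt = {|z|_w > 1}`, `S_ge = {|z|_w ≥ 1}`) — with their integrability from `IntegrableOn F₀`,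
proves the two CLOSED FORMS of PAPER-Z3 §1 from the shell identities as pure algebra, identifies `N₀ = {|z|_w ≤ 1} = {n ∈ I}`, and delivers the heads `h11v`, `hwwv` (and `hi₁₁`, `hiw₂`) of ★
`K2E3KeysThmTwoDepthZeroBranchBFromDet` ∕ ★ `…Assembly` in their exact shapes:
* §1 `theta_eq_one_of_apply_eq_one` (`hθ1` for `θ(b) = χ₁(b₀₀)`), `chi2_neg_one_sq` (`χ₂(−1)² = 1`), `setOf_v_le_one_eq_setOf_mem` (`{|z|_w ≤ 1} = {n ∈ I}`).
* §2 `toFun_weyl_mul_eq_mul_indicator` (`f(w₀) = 0`: `f(w₀n) = χ₂(−1)f(1)·𝟙_{S_gt}F₀(n)`), `toFun_conj_weyl_eq_mul_indicator` (`f(1) = 0`: `f(w₀nw₀) = χ₂(−1)f(w₀)·𝟙_{S_ge}F₀(n)`).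
* §3 `integral_toFun_weyl_mul_eq`, `integrable_toFun_weyl_mul`, `integral_toFun_conj_weyl_eq`, `integrable_toFun_conj_weyl`.
* §4 (algebra) `closedForm_ge` (`Ige = I0 + I1 + Y²·Ige`, `I1 = c·Y`, `I0 = −c`, `|Y| < 1` ⟹ `Ige = −c∕(1+Y)`), `closedForm_gt` (`Ige − I0 = c·Y∕(1+Y)`).
* §5 **`integral_weyl_one_eq_of_shells`** (`h11v`) and **`integral_weyl_weyl_eq_of_shells`** (`hwwv`) for the normalised basis vectors, from the three shell identities.
HONEST LABEL.  HC_CM is proved only modulo the 7 printed citations (2 remaining named inputs: hLiu418 = `stmt-HodgeConjecture-24832`, h413 = `stmt-HodgeConjecture-24833`) until rung 0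
closes; count-neutral — this file does NOT pay the leaf; no printed citation is discharged.

## References
* [Casselman1980] W. Casselman, Compositio Math. 40 (1980), §3 (the intertwining functionals on the Iwahori-type vectors).
* [Casselman1995] W. Casselman, *Introduction to the theory of admissible representations of `p`-adic reductive groups* (1995), §6.4 (rank-one intertwining integrals).
* [Keys1984] D. Keys, Compositio Math. 51 (1984), §7 Theorem (2) p. 126.
* [Rogawski1990] J. Rogawski, Ann. of Math. Stud. 123 (1990), §12.1 p. 171, §12.2 p. 173.
-/

set_option autoImplicit false
-- the mandated namespace has the single-problem summit's repeated segment (`HodgeConjecture.HodgeConjecture`)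
set_option linter.dupNamespace false

noncomputable section

open NumberField IsDedekindDomain MeasureTheory
open scoped Matrix MatrixGroups WithZero Valued NNReal
open Literature.NumberTheory Literature.NumberTheory.Automorphic Literature.NumberTheory.Automorphic.UnitaryGroup
open Literature.NumberTheory.Rogawski1990

namespace Summit.HodgeConjecture.HodgeConjecture.Cruxes.H413.K2E3BranchBCasselmanPairClosedForms

open Summit.HodgeConjecture.HodgeConjecture.Cruxes.H413
open Summit.HodgeConjecture.HodgeConjecture.Cruxes.H413.K2E3DepthZeroIwahoriCharacterCM
open Summit.HodgeConjecture.HodgeConjecture.Cruxes.H413.K2E3BranchATorusWitnessCM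
open Summit.HodgeConjecture.HodgeConjecture.Cruxes.H413.K2E3BranchBCellFunctionsCM
open Summit.HodgeConjecture.HodgeConjecture.Cruxes.H413.K2E3BranchBCasselmanPairEntries

variable (L : Type) [Field L] [NumberField L] [IsCMField L] (v : HeightOneSpectrum (𝓞 ↥(maximalRealSubfield L)))
  (w : PlacesOver L v) (hw : IsCMField.complexConj L • w.1 = w.1)
  (eA : Gqs L v ≃ₜ* ↥(unitaryGroupOfForm (galAdicCompletionMap (L := L) (IsCMField.complexConj L) hw) ((StdForm.antidiagonal 3).over (w.1.adicCompletion L))))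
  (heA : ∀ g : Gqs L v,
    ((eA g : ↥(unitaryGroupOfForm (galAdicCompletionMap (L := L) (IsCMField.complexConj L) hw) ((StdForm.antidiagonal 3).over (w.1.adicCompletion L)))) :
        GL (Fin 3) (w.1.adicCompletion L)) =
      ((localNonsplitEquiv (IsCMField.complexConj L) (qsForm L) (IsCMField.complexConj_ne_one L) w hw g :
        ↥(unitaryGroupOfForm (galAdicCompletionMap (L := L) (IsCMField.complexConj L) hw) (placeForm (qsForm L) w.1))) : GL (Fin 3) (w.1.adicCompletion L)))
  {ϖ : w.1.adicCompletion L} (hϖ : Valued.v ϖ = WithZero.exp (-1 : ℤ))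
  (g₁ : GL (Fin 3) (w.1.adicCompletion L)) (hg₁ : (g₁ : Matrix (Fin 3) (Fin 3) (w.1.adicCompletion L)) = Matrix.diagonal ![(1 : w.1.adicCompletion L), 1, ϖ])
  (K0 K1 I : Subgroup (Gqs L v))
  (hK0 : K0 = ((glInt 3 (w.1.adicCompletion L)).subgroupOf
    (unitaryGroupOfForm (galAdicCompletionMap (L := L) (IsCMField.complexConj L) hw) ((StdForm.antidiagonal 3).over (w.1.adicCompletion L)))).comap
      eA.toMulEquiv.toMonoidHom)
  (hK1 : K1 = (((glInt 3 (w.1.adicCompletion L)).map (MulAut.conj g₁).toMonoidHom).subgroupOf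
    (unitaryGroupOfForm (galAdicCompletionMap (L := L) (IsCMField.complexConj L) hw) ((StdForm.antidiagonal 3).over (w.1.adicCompletion L)))).comap
      eA.toMulEquiv.toMonoidHom)
  (hI : I = K0 ⊓ K1)
  (w₀ : ↥(unitaryGroupOfForm (conjLocal L (IsCMField.complexConj L) v) (cmLocalForm L 3 v))) (hw₀ : Units.val (w₀ : GL (Fin 3) (LocalRing L v)) = cmLocalForm L 3 v)
  (χ₁ : (LocalRing L v)ˣ →* ℂˣ) (χ₂ : ↥(normOneUnits (conjLocal L (IsCMField.complexConj L) v)) →* ℂˣ)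

/-! ## §4 The closed forms from the shell identities (algebra) -/

/-- **`Ige = −c∕(1+Y)`** from the torus scaling `Ige = I0 + I1 + Y²·Ige` ((II)-a), the shell-one value `I1 = c·Y` ((II)-a) and the shell-zero value `I0 = −c` ((II)-b3), on the disc
`|Y| < 1` (`1 − Y² ≠ 0`): PAPER-Z3 §1, `G₂∕χ₂(−1) = −c∕(1+Y)`. [cite: Keys1984, §7 Theorem (2) p. 126] [cite: Casselman1980, §3] -/
theorem closedForm_ge (Y c I0 I1 Ige : ℂ) (hY : ‖Y‖ < 1) (hscal : Ige = I0 + I1 + Y ^ 2 * Ige) (h1 : I1 = c * Y) (h0 : I0 = -c) :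
    Ige = -(c / (1 + Y)) := by
  have h1Y : 1 + Y ≠ 0 := by
    intro h
    have hYeq : Y = -1 := by linear_combination h
    rw [hYeq, norm_neg, norm_one] at hY
    exact lt_irrefl _ hY
  have h1Y' : 1 - Y ≠ 0 := by
    intro h
    have hYeq : Y = 1 := by linear_combination -h
    rw [hYeq, norm_one] at hY
    exact lt_irrefl _ hY
  rw [h1, h0] at hscal
  have key : (Ige * (1 + Y) + c) * (1 - Y) = 0 := by linear_combination hscal
  have h2 : Ige * (1 + Y) + c = 0 := (mul_eq_zero.1 key).resolve_right h1Y'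
  rw [← neg_div, eq_div_iff h1Y]
  linear_combination h2

/-- **`Ige − I0 = c·Y∕(1+Y)`** — PAPER-Z3 §1, `G₁∕χ₂(−1) = ∫_{S_gt} F₀ = ∫_{S_ge} F₀ − ∫_{Sh 0} F₀ = c·Y∕(1+Y)`. [cite: Keys1984, §7 Theorem (2) p. 126] [cite: Casselman1980, §3] -/
theorem closedForm_gt (Y c I0 I1 Ige : ℂ) (hY : ‖Y‖ < 1) (hscal : Ige = I0 + I1 + Y ^ 2 * Ige) (h1 : I1 = c * Y) (h0 : I0 = -c) :
    Ige - I0 = c * Y / (1 + Y) := by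
  have h1Y : 1 + Y ≠ 0 := by
    intro h
    have hYeq : Y = -1 := by linear_combination h
    rw [hYeq, norm_neg, norm_one] at hY
    exact lt_irrefl _ hY
  rw [closedForm_ge Y c I0 I1 Ige hY hscal h1 h0, h0]
  field_simp
  ring

/-! ## §5 The heads `h11v`, `hwwv` of the end assembly from the three shell identities -/

open Classical in
include hw heA hϖ hg₁ hK0 hK1 hI hw₀ in
set_option maxHeartbeats 1600000 in
set_option synthInstance.maxHeartbeats 400000 in
-- as in §2
/-- **`h11v`: `Λ_1 f₁ = χ₂(−1)·(ε₀·((q−1)∕q²)·μ(N₀)·Y∕(1+Y))`** for the normalised `f₁` (`f₁(1) = 1`, `f₁(w₀) = 0`), from the SHELL IDENTITIES on the frame-v1 integrand `F₀` —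
`hscal : ∫_{S_ge} F₀ = ∫_{Sh 0} F₀ + ∫_{Sh 1} F₀ + Y²·∫_{S_ge} F₀` and `h1 : ∫_{Sh 1} F₀ = ε₀·Y·((q−1)∕q²)·V` ((II)-a), `h0 : ∫_{Sh 0} F₀ = −(ε₀·((q−1)∕q²)·V)` ((II)-b3), `V = μ{|z|_w ≤ 1}` — the set
algebra `∫_{S_gt} = ∫_{S_ge} − ∫_{Sh 0}` (`S_ge = S_gt ⊔ Sh 0`, `IntegrableOn F₀ S_ge`), §3, §4 and `{|z|_w ≤ 1} = {n ∈ I}` (§1); output in the exact shape of ★ `…FromDet` ∕ ★ `…Assembly`.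
[cite: Keys1984, §7 Theorem (2) p. 126] [cite: Casselman1980, §3] [cite: Rogawski1990, §12.2 p. 173] -/
theorem integral_weyl_one_eq_of_shells [MeasurableSpace ↥(cmBorelTriple L 3 v).N] (μ : Measure ↥(cmBorelTriple L 3 v).N)
    (f : haveI := locallyCompactSpace_cmBorelU L 3 v
      Representation.SmoothInd (cmBorelTriple L 3 v).P
        (Representation.twist (((Representation.trivial ℂ ↥(torusU (conjLocal L (IsCMField.complexConj L) v) (cmLocalForm L 3 v)) ℂ).twist
            (cmTorusCharPair L v χ₁ χ₂)).comp (cmBorelTriple L 3 v).proj) (rootDeltaChar (cmBorelTriple L 3 v).P)))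
    (heig : haveI := locallyCompactSpace_cmBorelU L 3 v
      ∀ j ∈ I, Representation.smoothIndRep (cmBorelTriple L 3 v).P _ j f =
        (fun g : Gqs L v => if h : IsUnit (((g.val : GL (Fin 3) (LocalRing L v)) : Matrix (Fin 3) (Fin 3) (LocalRing L v)) 0 0) then ((χ₁ h.unit : ℂˣ) : ℂ) else 0) j • f)
    (h11 : f.toFun 1 = 1) (h1g : f.toFun w₀ = 0)
    (hSgt : MeasurableSet {m : ↥(cmBorelTriple L 3 v).N | 1 < Valued.v (((((m : ↥(unitaryGroupOfForm (conjLocal L (IsCMField.complexConj L) v) (cmLocalForm L 3 v))) : GL (Fin 3) (LocalRing L v)) : Matrix (Fin 3) (Fin 3) (LocalRing L v)) 0 2) w)}) (hSh0 : MeasurableSet {m : ↥(cmBorelTriple L 3 v).N | Valued.v (((((m : ↥(unitaryGroupOfForm (conjLocal L (IsCMField.complexConj L) v) (cmLocalForm L 3 v))) : GL (Fin 3) (LocalRing L v)) : Matrix (Fin 3) (Fin 3) (LocalRing L v)) 0 2) w) = 1})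
    (hint : IntegrableOn (fun n : ↥(cmBorelTriple L 3 v).N =>
        if h : IsUnit ((((n : ↥(unitaryGroupOfForm (conjLocal L (IsCMField.complexConj L) v) (cmLocalForm L 3 v))) : GL (Fin 3) (LocalRing L v)) : Matrix (Fin 3) (Fin 3) (LocalRing L v)) 0 2) then
          ((((χ₁ (Units.map ((conjLocal L (IsCMField.complexConj L) v) : LocalRing L v →* LocalRing L v) h.unit))⁻¹ : ℂˣ) : ℂ) *
            ((((unitModulusChar (LocalRing L v) h.unit)⁻¹ : ℝ≥0) : ℝ) : ℂ))
        else 0) {m : ↥(cmBorelTriple L 3 v).N | 1 ≤ Valued.v (((((m : ↥(unitaryGroupOfForm (conjLocal L (IsCMField.complexConj L) v) (cmLocalForm L 3 v))) : GL (Fin 3) (LocalRing L v)) : Matrix (Fin 3) (Fin 3) (LocalRing L v)) 0 2) w)} μ)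
    (ε₀ : ℂ) (hY : ‖((χ₁ (isUnit_toLocalRing_uniformizer L v).unit : ℂˣ) : ℂ)‖ < 1)
    (hscal : ∫ n in {m : ↥(cmBorelTriple L 3 v).N | 1 ≤ Valued.v (((((m : ↥(unitaryGroupOfForm (conjLocal L (IsCMField.complexConj L) v) (cmLocalForm L 3 v))) : GL (Fin 3) (LocalRing L v)) : Matrix (Fin 3) (Fin 3) (LocalRing L v)) 0 2) w)}, (fun n : ↥(cmBorelTriple L 3 v).N =>
        if h : IsUnit ((((n : ↥(unitaryGroupOfForm (conjLocal L (IsCMField.complexConj L) v) (cmLocalForm L 3 v))) : GL (Fin 3) (LocalRing L v)) : Matrix (Fin 3) (Fin 3) (LocalRing L v)) 0 2) then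
          ((((χ₁ (Units.map ((conjLocal L (IsCMField.complexConj L) v) : LocalRing L v →* LocalRing L v) h.unit))⁻¹ : ℂˣ) : ℂ) *
            ((((unitModulusChar (LocalRing L v) h.unit)⁻¹ : ℝ≥0) : ℝ) : ℂ))
        else 0) n ∂μ =
      (∫ n in {m : ↥(cmBorelTriple L 3 v).N | Valued.v (((((m : ↥(unitaryGroupOfForm (conjLocal L (IsCMField.complexConj L) v) (cmLocalForm L 3 v))) : GL (Fin 3) (LocalRing L v)) : Matrix (Fin 3) (Fin 3) (LocalRing L v)) 0 2) w) = 1}, (fun n : ↥(cmBorelTriple L 3 v).N =>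
        if h : IsUnit ((((n : ↥(unitaryGroupOfForm (conjLocal L (IsCMField.complexConj L) v) (cmLocalForm L 3 v))) : GL (Fin 3) (LocalRing L v)) : Matrix (Fin 3) (Fin 3) (LocalRing L v)) 0 2) then
          ((((χ₁ (Units.map ((conjLocal L (IsCMField.complexConj L) v) : LocalRing L v →* LocalRing L v) h.unit))⁻¹ : ℂˣ) : ℂ) *
            ((((unitModulusChar (LocalRing L v) h.unit)⁻¹ : ℝ≥0) : ℝ) : ℂ))
        else 0) n ∂μ) + (∫ n in {m : ↥(cmBorelTriple L 3 v).N | Valued.v (((((m : ↥(unitaryGroupOfForm (conjLocal L (IsCMField.complexConj L) v) (cmLocalForm L 3 v))) : GL (Fin 3) (LocalRing L v)) : Matrix (Fin 3) (Fin 3) (LocalRing L v)) 0 2) w) = WithZero.exp (1 : ℤ)}, (fun n : ↥(cmBorelTriple L 3 v).N =>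
        if h : IsUnit ((((n : ↥(unitaryGroupOfForm (conjLocal L (IsCMField.complexConj L) v) (cmLocalForm L 3 v))) : GL (Fin 3) (LocalRing L v)) : Matrix (Fin 3) (Fin 3) (LocalRing L v)) 0 2) then
          ((((χ₁ (Units.map ((conjLocal L (IsCMField.complexConj L) v) : LocalRing L v →* LocalRing L v) h.unit))⁻¹ : ℂˣ) : ℂ) *
            ((((unitModulusChar (LocalRing L v) h.unit)⁻¹ : ℝ≥0) : ℝ) : ℂ))
        else 0) n ∂μ) +
        ((χ₁ (isUnit_toLocalRing_uniformizer L v).unit : ℂˣ) : ℂ) ^ 2 * ∫ n in {m : ↥(cmBorelTriple L 3 v).N | 1 ≤ Valued.v (((((m : ↥(unitaryGroupOfForm (conjLocal L (IsCMField.complexConj L) v) (cmLocalForm L 3 v))) : GL (Fin 3) (LocalRing L v)) : Matrix (Fin 3) (Fin 3) (LocalRing L v)) 0 2) w)}, (fun n : ↥(cmBorelTriple L 3 v).N =>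
        if h : IsUnit ((((n : ↥(unitaryGroupOfForm (conjLocal L (IsCMField.complexConj L) v) (cmLocalForm L 3 v))) : GL (Fin 3) (LocalRing L v)) : Matrix (Fin 3) (Fin 3) (LocalRing L v)) 0 2) then
          ((((χ₁ (Units.map ((conjLocal L (IsCMField.complexConj L) v) : LocalRing L v →* LocalRing L v) h.unit))⁻¹ : ℂˣ) : ℂ) *
            ((((unitModulusChar (LocalRing L v) h.unit)⁻¹ : ℝ≥0) : ℝ) : ℂ))
        else 0) n ∂μ)
    (h1 : ∫ n in {m : ↥(cmBorelTriple L 3 v).N | Valued.v (((((m : ↥(unitaryGroupOfForm (conjLocal L (IsCMField.complexConj L) v) (cmLocalForm L 3 v))) : GL (Fin 3) (LocalRing L v)) : Matrix (Fin 3) (Fin 3) (LocalRing L v)) 0 2) w) = WithZero.exp (1 : ℤ)}, (fun n : ↥(cmBorelTriple L 3 v).N =>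
        if h : IsUnit ((((n : ↥(unitaryGroupOfForm (conjLocal L (IsCMField.complexConj L) v) (cmLocalForm L 3 v))) : GL (Fin 3) (LocalRing L v)) : Matrix (Fin 3) (Fin 3) (LocalRing L v)) 0 2) then
          ((((χ₁ (Units.map ((conjLocal L (IsCMField.complexConj L) v) : LocalRing L v →* LocalRing L v) h.unit))⁻¹ : ℂˣ) : ℂ) *
            ((((unitModulusChar (LocalRing L v) h.unit)⁻¹ : ℝ≥0) : ℝ) : ℂ))
        else 0) n ∂μ =
      ε₀ * ((χ₁ (isUnit_toLocalRing_uniformizer L v).unit : ℂˣ) : ℂ) * ((((Ideal.absNorm v.asIdeal : ℝ) : ℂ) - 1) / ((Ideal.absNorm v.asIdeal : ℝ) : ℂ) ^ 2) * ((μ.real {m : ↥(cmBorelTriple L 3 v).N | Valued.v (((((m : ↥(unitaryGroupOfForm (conjLocal L (IsCMField.complexConj L) v) (cmLocalForm L 3 v))) : GL (Fin 3) (LocalRing L v)) : Matrix (Fin 3) (Fin 3) (LocalRing L v)) 0 2) w) ≤ 1} : ℝ) : ℂ))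
    (h0 : ∫ n in {m : ↥(cmBorelTriple L 3 v).N | Valued.v (((((m : ↥(unitaryGroupOfForm (conjLocal L (IsCMField.complexConj L) v) (cmLocalForm L 3 v))) : GL (Fin 3) (LocalRing L v)) : Matrix (Fin 3) (Fin 3) (LocalRing L v)) 0 2) w) = 1}, (fun n : ↥(cmBorelTriple L 3 v).N =>
        if h : IsUnit ((((n : ↥(unitaryGroupOfForm (conjLocal L (IsCMField.complexConj L) v) (cmLocalForm L 3 v))) : GL (Fin 3) (LocalRing L v)) : Matrix (Fin 3) (Fin 3) (LocalRing L v)) 0 2) then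
          ((((χ₁ (Units.map ((conjLocal L (IsCMField.complexConj L) v) : LocalRing L v →* LocalRing L v) h.unit))⁻¹ : ℂˣ) : ℂ) *
            ((((unitModulusChar (LocalRing L v) h.unit)⁻¹ : ℝ≥0) : ℝ) : ℂ))
        else 0) n ∂μ = -(ε₀ * ((((Ideal.absNorm v.asIdeal : ℝ) : ℂ) - 1) / ((Ideal.absNorm v.asIdeal : ℝ) : ℂ) ^ 2) * ((μ.real {m : ↥(cmBorelTriple L 3 v).N | Valued.v (((((m : ↥(unitaryGroupOfForm (conjLocal L (IsCMField.complexConj L) v) (cmLocalForm L 3 v))) : GL (Fin 3) (LocalRing L v)) : Matrix (Fin 3) (Fin 3) (LocalRing L v)) 0 2) w) ≤ 1} : ℝ) : ℂ))) :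
    ∫ n : ↥(cmBorelTriple L 3 v).N, f.toFun (w₀ * (n : ↥(unitaryGroupOfForm (conjLocal L (IsCMField.complexConj L) v) (cmLocalForm L 3 v))) * 1) ∂μ =
      ((χ₂ ⟨-1, F0P3cStCharTSBigCellFactorisation.neg_one_mem_normOneUnits (conjLocal L (IsCMField.complexConj L) v)⟩ : ℂˣ) : ℂ) * (ε₀ * ((((Ideal.absNorm v.asIdeal : ℝ) : ℂ) - 1) / ((Ideal.absNorm v.asIdeal : ℝ) : ℂ) ^ 2) * ((μ.real {m : ↥(cmBorelTriple L 3 v).N | (m : ↥(unitaryGroupOfForm (conjLocal L (IsCMField.complexConj L) v) (cmLocalForm L 3 v))) ∈ I} : ℝ) : ℂ) * ((χ₁ (isUnit_toLocalRing_uniformizer L v).unit : ℂˣ) : ℂ) / (1 + ((χ₁ (isUnit_toLocalRing_uniformizer L v).unit : ℂˣ) : ℂ))) := by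
  -- `S_ge = S_gt ∪ Sh 0` (disjoint), so `∫_{S_gt} F₀ = ∫_{S_ge} F₀ − ∫_{Sh 0} F₀`
  have hunion : {m : ↥(cmBorelTriple L 3 v).N | 1 ≤ Valued.v (((((m : ↥(unitaryGroupOfForm (conjLocal L (IsCMField.complexConj L) v) (cmLocalForm L 3 v))) : GL (Fin 3) (LocalRing L v)) : Matrix (Fin 3) (Fin 3) (LocalRing L v)) 0 2) w)} = {m : ↥(cmBorelTriple L 3 v).N | 1 < Valued.v (((((m : ↥(unitaryGroupOfForm (conjLocal L (IsCMField.complexConj L) v) (cmLocalForm L 3 v))) : GL (Fin 3) (LocalRing L v)) : Matrix (Fin 3) (Fin 3) (LocalRing L v)) 0 2) w)} ∪ {m : ↥(cmBorelTriple L 3 v).N | Valued.v (((((m : ↥(unitaryGroupOfForm (conjLocal L (IsCMField.complexConj L) v) (cmLocalForm L 3 v))) : GL (Fin 3) (LocalRing L v)) : Matrix (Fin 3) (Fin 3) (LocalRing L v)) 0 2) w) = 1} := by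
    ext m; simp only [Set.mem_setOf_eq, Set.mem_union]; exact le_iff_lt_or_eq.trans (or_congr Iff.rfl eq_comm)
  have hdisj : Disjoint {m : ↥(cmBorelTriple L 3 v).N | 1 < Valued.v (((((m : ↥(unitaryGroupOfForm (conjLocal L (IsCMField.complexConj L) v) (cmLocalForm L 3 v))) : GL (Fin 3) (LocalRing L v)) : Matrix (Fin 3) (Fin 3) (LocalRing L v)) 0 2) w)} {m : ↥(cmBorelTriple L 3 v).N | Valued.v (((((m : ↥(unitaryGroupOfForm (conjLocal L (IsCMField.complexConj L) v) (cmLocalForm L 3 v))) : GL (Fin 3) (LocalRing L v)) : Matrix (Fin 3) (Fin 3) (LocalRing L v)) 0 2) w) = 1} := by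
    rw [Set.disjoint_left]; intro m hm hm0
    simp only [Set.mem_setOf_eq] at hm hm0
    rw [hm0] at hm; exact lt_irrefl _ hm
  have hIgt : IntegrableOn (fun n : ↥(cmBorelTriple L 3 v).N =>
        if h : IsUnit ((((n : ↥(unitaryGroupOfForm (conjLocal L (IsCMField.complexConj L) v) (cmLocalForm L 3 v))) : GL (Fin 3) (LocalRing L v)) : Matrix (Fin 3) (Fin 3) (LocalRing L v)) 0 2) then
          ((((χ₁ (Units.map ((conjLocal L (IsCMField.complexConj L) v) : LocalRing L v →* LocalRing L v) h.unit))⁻¹ : ℂˣ) : ℂ) *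
            ((((unitModulusChar (LocalRing L v) h.unit)⁻¹ : ℝ≥0) : ℝ) : ℂ))
        else 0) {m : ↥(cmBorelTriple L 3 v).N | 1 < Valued.v (((((m : ↥(unitaryGroupOfForm (conjLocal L (IsCMField.complexConj L) v) (cmLocalForm L 3 v))) : GL (Fin 3) (LocalRing L v)) : Matrix (Fin 3) (Fin 3) (LocalRing L v)) 0 2) w)} μ := hint.mono_set (by rw [hunion]; exact Set.subset_union_left)
  have hI0 : IntegrableOn (fun n : ↥(cmBorelTriple L 3 v).N =>
        if h : IsUnit ((((n : ↥(unitaryGroupOfForm (conjLocal L (IsCMField.complexConj L) v) (cmLocalForm L 3 v))) : GL (Fin 3) (LocalRing L v)) : Matrix (Fin 3) (Fin 3) (LocalRing L v)) 0 2) then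
          ((((χ₁ (Units.map ((conjLocal L (IsCMField.complexConj L) v) : LocalRing L v →* LocalRing L v) h.unit))⁻¹ : ℂˣ) : ℂ) *
            ((((unitModulusChar (LocalRing L v) h.unit)⁻¹ : ℝ≥0) : ℝ) : ℂ))
        else 0) {m : ↥(cmBorelTriple L 3 v).N | Valued.v (((((m : ↥(unitaryGroupOfForm (conjLocal L (IsCMField.complexConj L) v) (cmLocalForm L 3 v))) : GL (Fin 3) (LocalRing L v)) : Matrix (Fin 3) (Fin 3) (LocalRing L v)) 0 2) w) = 1} μ := hint.mono_set (by rw [hunion]; exact Set.subset_union_right)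
  have hsplit := setIntegral_union hdisj hSh0 hIgt hI0
  rw [← hunion] at hsplit
  -- the closed form for `∫_{S_gt} F₀`
  have hgt := closedForm_gt ((χ₁ (isUnit_toLocalRing_uniformizer L v).unit : ℂˣ) : ℂ) (ε₀ * ((((Ideal.absNorm v.asIdeal : ℝ) : ℂ) - 1) / ((Ideal.absNorm v.asIdeal : ℝ) : ℂ) ^ 2) * ((μ.real {m : ↥(cmBorelTriple L 3 v).N | Valued.v (((((m : ↥(unitaryGroupOfForm (conjLocal L (IsCMField.complexConj L) v) (cmLocalForm L 3 v))) : GL (Fin 3) (LocalRing L v)) : Matrix (Fin 3) (Fin 3) (LocalRing L v)) 0 2) w) ≤ 1} : ℝ) : ℂ)) _ _ _ hY hscal (by rw [h1]; ring) h0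
  rw [hsplit, add_sub_cancel_right] at hgt
  rw [integral_toFun_weyl_mul_eq L v w hw eA heA hϖ g₁ hg₁ K0 K1 I hK0 hK1 hI w₀ hw₀ χ₁ χ₂ μ f heig h1g hSgt, hgt, h11,
    ← setOf_v_le_one_eq_setOf_mem L v w hw eA heA hϖ g₁ hg₁ K0 K1 I hK0 hK1 hI]
  ring

open Classical in
include hw heA hϖ hg₁ hK0 hK1 hI hw₀ in
set_option maxHeartbeats 1600000 in
set_option synthInstance.maxHeartbeats 400000 in
-- as in §2
/-- **`hwwv`: `Λ_{w₀} f_w = −χ₂(−1)·(ε₀·((q−1)∕q²)·μ(N₀)∕(1+Y))`** for the normalised `f_w` (`f_w(1) = 0`, `f_w(w₀) = 1`), from the same three shell identities (§3, §4 `closedForm_ge`, §1).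
[cite: Keys1984, §7 Theorem (2) p. 126] [cite: Casselman1980, §3] [cite: Rogawski1990, §12.2 p. 173] -/
theorem integral_weyl_weyl_eq_of_shells [MeasurableSpace ↥(cmBorelTriple L 3 v).N] (μ : Measure ↥(cmBorelTriple L 3 v).N)
    (f : haveI := locallyCompactSpace_cmBorelU L 3 v
      Representation.SmoothInd (cmBorelTriple L 3 v).P
        (Representation.twist (((Representation.trivial ℂ ↥(torusU (conjLocal L (IsCMField.complexConj L) v) (cmLocalForm L 3 v)) ℂ).twist
            (cmTorusCharPair L v χ₁ χ₂)).comp (cmBorelTriple L 3 v).proj) (rootDeltaChar (cmBorelTriple L 3 v).P)))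
    (heig : haveI := locallyCompactSpace_cmBorelU L 3 v
      ∀ j ∈ I, Representation.smoothIndRep (cmBorelTriple L 3 v).P _ j f =
        (fun g : Gqs L v => if h : IsUnit (((g.val : GL (Fin 3) (LocalRing L v)) : Matrix (Fin 3) (Fin 3) (LocalRing L v)) 0 0) then ((χ₁ h.unit : ℂˣ) : ℂ) else 0) j • f)
    (hw1 : f.toFun 1 = 0) (hwg : f.toFun w₀ = 1)
    (hSge : MeasurableSet {m : ↥(cmBorelTriple L 3 v).N | 1 ≤ Valued.v (((((m : ↥(unitaryGroupOfForm (conjLocal L (IsCMField.complexConj L) v) (cmLocalForm L 3 v))) : GL (Fin 3) (LocalRing L v)) : Matrix (Fin 3) (Fin 3) (LocalRing L v)) 0 2) w)})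
    (ε₀ : ℂ) (hY : ‖((χ₁ (isUnit_toLocalRing_uniformizer L v).unit : ℂˣ) : ℂ)‖ < 1)
    (hscal : ∫ n in {m : ↥(cmBorelTriple L 3 v).N | 1 ≤ Valued.v (((((m : ↥(unitaryGroupOfForm (conjLocal L (IsCMField.complexConj L) v) (cmLocalForm L 3 v))) : GL (Fin 3) (LocalRing L v)) : Matrix (Fin 3) (Fin 3) (LocalRing L v)) 0 2) w)}, (fun n : ↥(cmBorelTriple L 3 v).N =>
        if h : IsUnit ((((n : ↥(unitaryGroupOfForm (conjLocal L (IsCMField.complexConj L) v) (cmLocalForm L 3 v))) : GL (Fin 3) (LocalRing L v)) : Matrix (Fin 3) (Fin 3) (LocalRing L v)) 0 2) then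
          ((((χ₁ (Units.map ((conjLocal L (IsCMField.complexConj L) v) : LocalRing L v →* LocalRing L v) h.unit))⁻¹ : ℂˣ) : ℂ) *
            ((((unitModulusChar (LocalRing L v) h.unit)⁻¹ : ℝ≥0) : ℝ) : ℂ))
        else 0) n ∂μ =
      (∫ n in {m : ↥(cmBorelTriple L 3 v).N | Valued.v (((((m : ↥(unitaryGroupOfForm (conjLocal L (IsCMField.complexConj L) v) (cmLocalForm L 3 v))) : GL (Fin 3) (LocalRing L v)) : Matrix (Fin 3) (Fin 3) (LocalRing L v)) 0 2) w) = 1}, (fun n : ↥(cmBorelTriple L 3 v).N =>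
        if h : IsUnit ((((n : ↥(unitaryGroupOfForm (conjLocal L (IsCMField.complexConj L) v) (cmLocalForm L 3 v))) : GL (Fin 3) (LocalRing L v)) : Matrix (Fin 3) (Fin 3) (LocalRing L v)) 0 2) then
          ((((χ₁ (Units.map ((conjLocal L (IsCMField.complexConj L) v) : LocalRing L v →* LocalRing L v) h.unit))⁻¹ : ℂˣ) : ℂ) *
            ((((unitModulusChar (LocalRing L v) h.unit)⁻¹ : ℝ≥0) : ℝ) : ℂ))
        else 0) n ∂μ) + (∫ n in {m : ↥(cmBorelTriple L 3 v).N | Valued.v (((((m : ↥(unitaryGroupOfForm (conjLocal L (IsCMField.complexConj L) v) (cmLocalForm L 3 v))) : GL (Fin 3) (LocalRing L v)) : Matrix (Fin 3) (Fin 3) (LocalRing L v)) 0 2) w) = WithZero.exp (1 : ℤ)}, (fun n : ↥(cmBorelTriple L 3 v).N =>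
        if h : IsUnit ((((n : ↥(unitaryGroupOfForm (conjLocal L (IsCMField.complexConj L) v) (cmLocalForm L 3 v))) : GL (Fin 3) (LocalRing L v)) : Matrix (Fin 3) (Fin 3) (LocalRing L v)) 0 2) then
          ((((χ₁ (Units.map ((conjLocal L (IsCMField.complexConj L) v) : LocalRing L v →* LocalRing L v) h.unit))⁻¹ : ℂˣ) : ℂ) *
            ((((unitModulusChar (LocalRing L v) h.unit)⁻¹ : ℝ≥0) : ℝ) : ℂ))
        else 0) n ∂μ) +
        ((χ₁ (isUnit_toLocalRing_uniformizer L v).unit : ℂˣ) : ℂ) ^ 2 * ∫ n in {m : ↥(cmBorelTriple L 3 v).N | 1 ≤ Valued.v (((((m : ↥(unitaryGroupOfForm (conjLocal L (IsCMField.complexConj L) v) (cmLocalForm L 3 v))) : GL (Fin 3) (LocalRing L v)) : Matrix (Fin 3) (Fin 3) (LocalRing L v)) 0 2) w)}, (fun n : ↥(cmBorelTriple L 3 v).N =>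
        if h : IsUnit ((((n : ↥(unitaryGroupOfForm (conjLocal L (IsCMField.complexConj L) v) (cmLocalForm L 3 v))) : GL (Fin 3) (LocalRing L v)) : Matrix (Fin 3) (Fin 3) (LocalRing L v)) 0 2) then
          ((((χ₁ (Units.map ((conjLocal L (IsCMField.complexConj L) v) : LocalRing L v →* LocalRing L v) h.unit))⁻¹ : ℂˣ) : ℂ) *
            ((((unitModulusChar (LocalRing L v) h.unit)⁻¹ : ℝ≥0) : ℝ) : ℂ))
        else 0) n ∂μ)
    (h1 : ∫ n in {m : ↥(cmBorelTriple L 3 v).N | Valued.v (((((m : ↥(unitaryGroupOfForm (conjLocal L (IsCMField.complexConj L) v) (cmLocalForm L 3 v))) : GL (Fin 3) (LocalRing L v)) : Matrix (Fin 3) (Fin 3) (LocalRing L v)) 0 2) w) = WithZero.exp (1 : ℤ)}, (fun n : ↥(cmBorelTriple L 3 v).N =>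
        if h : IsUnit ((((n : ↥(unitaryGroupOfForm (conjLocal L (IsCMField.complexConj L) v) (cmLocalForm L 3 v))) : GL (Fin 3) (LocalRing L v)) : Matrix (Fin 3) (Fin 3) (LocalRing L v)) 0 2) then
          ((((χ₁ (Units.map ((conjLocal L (IsCMField.complexConj L) v) : LocalRing L v →* LocalRing L v) h.unit))⁻¹ : ℂˣ) : ℂ) *
            ((((unitModulusChar (LocalRing L v) h.unit)⁻¹ : ℝ≥0) : ℝ) : ℂ))
        else 0) n ∂μ =
      ε₀ * ((χ₁ (isUnit_toLocalRing_uniformizer L v).unit : ℂˣ) : ℂ) * ((((Ideal.absNorm v.asIdeal : ℝ) : ℂ) - 1) / ((Ideal.absNorm v.asIdeal : ℝ) : ℂ) ^ 2) * ((μ.real {m : ↥(cmBorelTriple L 3 v).N | Valued.v (((((m : ↥(unitaryGroupOfForm (conjLocal L (IsCMField.complexConj L) v) (cmLocalForm L 3 v))) : GL (Fin 3) (LocalRing L v)) : Matrix (Fin 3) (Fin 3) (LocalRing L v)) 0 2) w) ≤ 1} : ℝ) : ℂ))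
    (h0 : ∫ n in {m : ↥(cmBorelTriple L 3 v).N | Valued.v (((((m : ↥(unitaryGroupOfForm (conjLocal L (IsCMField.complexConj L) v) (cmLocalForm L 3 v))) : GL (Fin 3) (LocalRing L v)) : Matrix (Fin 3) (Fin 3) (LocalRing L v)) 0 2) w) = 1}, (fun n : ↥(cmBorelTriple L 3 v).N =>
        if h : IsUnit ((((n : ↥(unitaryGroupOfForm (conjLocal L (IsCMField.complexConj L) v) (cmLocalForm L 3 v))) : GL (Fin 3) (LocalRing L v)) : Matrix (Fin 3) (Fin 3) (LocalRing L v)) 0 2) then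
          ((((χ₁ (Units.map ((conjLocal L (IsCMField.complexConj L) v) : LocalRing L v →* LocalRing L v) h.unit))⁻¹ : ℂˣ) : ℂ) *
            ((((unitModulusChar (LocalRing L v) h.unit)⁻¹ : ℝ≥0) : ℝ) : ℂ))
        else 0) n ∂μ = -(ε₀ * ((((Ideal.absNorm v.asIdeal : ℝ) : ℂ) - 1) / ((Ideal.absNorm v.asIdeal : ℝ) : ℂ) ^ 2) * ((μ.real {m : ↥(cmBorelTriple L 3 v).N | Valued.v (((((m : ↥(unitaryGroupOfForm (conjLocal L (IsCMField.complexConj L) v) (cmLocalForm L 3 v))) : GL (Fin 3) (LocalRing L v)) : Matrix (Fin 3) (Fin 3) (LocalRing L v)) 0 2) w) ≤ 1} : ℝ) : ℂ))) :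
    ∫ n : ↥(cmBorelTriple L 3 v).N, f.toFun (w₀ * (n : ↥(unitaryGroupOfForm (conjLocal L (IsCMField.complexConj L) v) (cmLocalForm L 3 v))) * w₀) ∂μ =
      -(((χ₂ ⟨-1, F0P3cStCharTSBigCellFactorisation.neg_one_mem_normOneUnits (conjLocal L (IsCMField.complexConj L) v)⟩ : ℂˣ) : ℂ) * (ε₀ * ((((Ideal.absNorm v.asIdeal : ℝ) : ℂ) - 1) / ((Ideal.absNorm v.asIdeal : ℝ) : ℂ) ^ 2) * ((μ.real {m : ↥(cmBorelTriple L 3 v).N | (m : ↥(unitaryGroupOfForm (conjLocal L (IsCMField.complexConj L) v) (cmLocalForm L 3 v))) ∈ I} : ℝ) : ℂ) / (1 + ((χ₁ (isUnit_toLocalRing_uniformizer L v).unit : ℂˣ) : ℂ)))) := by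
  have hge := closedForm_ge ((χ₁ (isUnit_toLocalRing_uniformizer L v).unit : ℂˣ) : ℂ) (ε₀ * ((((Ideal.absNorm v.asIdeal : ℝ) : ℂ) - 1) / ((Ideal.absNorm v.asIdeal : ℝ) : ℂ) ^ 2) * ((μ.real {m : ↥(cmBorelTriple L 3 v).N | Valued.v (((((m : ↥(unitaryGroupOfForm (conjLocal L (IsCMField.complexConj L) v) (cmLocalForm L 3 v))) : GL (Fin 3) (LocalRing L v)) : Matrix (Fin 3) (Fin 3) (LocalRing L v)) 0 2) w) ≤ 1} : ℝ) : ℂ)) _ _ _ hY hscal (by rw [h1]; ring) h0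
  rw [integral_toFun_conj_weyl_eq L v w hw eA heA hϖ g₁ hg₁ K0 K1 I hK0 hK1 hI w₀ hw₀ χ₁ χ₂ μ f heig hw1 hSge, hge, hwg,
    ← setOf_v_le_one_eq_setOf_mem L v w hw eA heA hϖ g₁ hg₁ K0 K1 I hK0 hK1 hI]
  ring

end Summit.HodgeConjecture.HodgeConjecture.Cruxes.H413.K2E3BranchBCasselmanPairClosedForms

end
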